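import Summits.CriticalPhenomena.CardyFormulaZ2.Theorems.CardyBoundaryCoulombGasRectilinearCardyStubKernelPointAsymptoticsPart2
import HarnessLib

/-!
# Stub `stub_kernelPointAsymptotics` of line `excursion-kernel-covariance`: uniform point asymptotics
# of the cube-root weight (crux `RectilinearCardy`, stmt-CriticalPhenomena-5660, route `CardyBoundaryCoulombGas`)

The registered statement: for a rectilinear conformal rectangle `R = (Ω; a, b, c, d)` with flat marks
and a conformal bijection `w : Ω → ℍ` holomorphic on an open `U ⊇ Ω ∪ {a, b, d}`, there is ONE
normaliser `N : ℝ → ℝ`, `N > 0`, such that on every admissible flat window `∂Ω([σ, σ']) ⊆ U` separated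
by `w` from the poles, UNIFORMLY in boundary-row vertices `v` within `4δ` of a window point `∂Ω(τ)`,
`rowWeight R δ v / (δ N(δ)) = |w′(∂Ω(τ))| (∏_{i=0,1,3} |w(∂Ω(τ)) − w(pt i)|²)^{-1/3} + o(1)` as
`δ → 0⁺`.

Proof (this file is the assembly; Parts 1–2 carry the lattice geometry and the sequential limit):
`N(δ) = Π(δ)^{1/3}` with the reference product `Π(δ) = ∏ᵢ G_δ(c_δ, pⁱ_δ) |w u₀ − w(pt i)|²/Im w(u₀)`
(`u₀ ∈ Ω` fixed, `c_δ` its nearest site, `pⁱ_δ = markRow R δ i`; `N = 1` where `Π ≤ 0`). If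
uniformity failed for some window and `ε`, `Filter.frequently_iff_seq_forall` extracts meshes
`δ_n → 0⁺` with violators `v_n`, `τ_n`; by compactness `τ_n → τ⋆` along a subsequence, and
`δ_n v_n → x = ∂Ω(τ⋆)`, a flat point of `U`. Part 2 (`kpa_seq_limit`, three instances of the tree's PROVED
Chelkak–Smirnov Thm 3.13 fact) gives `rowWeight/(δ_n N(δ_n)) → Φ_w(x)`, while
`Φ_w(∂Ω(τ_n)) → Φ_w(x)` by continuity (`kpa_tendsto_pointKernel`) — contradiction.

[cite: ChelkakSmirnov2011, Thm. 3.13] for the fact (via Part 2); the assembly is [folklore].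
-/

noncomputable section

open Set Filter Topology Metric
open Literature.Probability.RandomPlanarGeometry
open Literature.Probability.LatticeModels (Site meshPoint meshVertices meshVertices_finite dirichletGreen
  zdGraph nearestSite)
open Summit.CriticalPhenomena.CardyFormulaZ2.Theorems.RectilinearCardy.Negative (IsRectilinear)

namespace Summit.CriticalPhenomena.CardyFormulaZ2.Cruxes.RectilinearCardy.ExcursionKernelCovariance

/-! ### Continuity of the continuum kernel along the boundary -/

/-- **The continuum point kernel `Φ_w(∂Ω(τ)) = |w′| (∏ᵢ |w − w(pt i)|²)^{-1/3}` is continuous along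
the boundary** at a parameter `τ₀` with `∂Ω(τ₀) ∈ U` and `w(∂Ω(τ₀)) ≠ w(pt i)`: `w` and `w′` are
continuous on the open set `U` (holomorphy), the loop is continuous, and `t ↦ t^{-1/3}` is continuous
at the positive base. [folklore] -/
theorem kpa_tendsto_pointKernel (R : ConformalRectangle) {U : Set ℂ} {w : ℂ → ℂ} (hU : IsOpen U)
    (hw : DifferentiableOn ℂ w U) {τ : ℕ → ℝ} {τ₀ : ℝ} (hτ : Tendsto τ atTop (𝓝 τ₀))
    (hxU : R.boundary τ₀ ∈ U) (h0 : w (R.boundary τ₀) ≠ w (R.pt 0))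
    (h1 : w (R.boundary τ₀) ≠ w (R.pt 1)) (h3 : w (R.boundary τ₀) ≠ w (R.pt 3)) :
    Tendsto (fun n => ‖deriv w (R.boundary (τ n))‖ *
        (‖w (R.boundary (τ n)) - w (R.pt 0)‖ ^ 2 * ‖w (R.boundary (τ n)) - w (R.pt 1)‖ ^ 2 *
          ‖w (R.boundary (τ n)) - w (R.pt 3)‖ ^ 2) ^ (-(1 / 3 : ℝ))) atTop
      (𝓝 (‖deriv w (R.boundary τ₀)‖ *
        (‖w (R.boundary τ₀) - w (R.pt 0)‖ ^ 2 * ‖w (R.boundary τ₀) - w (R.pt 1)‖ ^ 2 *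
          ‖w (R.boundary τ₀) - w (R.pt 3)‖ ^ 2) ^ (-(1 / 3 : ℝ)))) := by
  have hb : Tendsto (fun n => R.boundary (τ n)) atTop (𝓝 (R.boundary τ₀)) :=
    (R.continuous_boundary.tendsto τ₀).comp hτ
  have hwc : ContinuousAt w (R.boundary τ₀) := (hw.differentiableAt (hU.mem_nhds hxU)).continuousAt
  have hdc : ContinuousAt (deriv w) (R.boundary τ₀) :=
    (hw.analyticOnNhd hU).deriv.continuousOn.continuousAt (hU.mem_nhds hxU)
  have hwτ : Tendsto (fun n => w (R.boundary (τ n))) atTop (𝓝 (w (R.boundary τ₀))) :=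
    hwc.tendsto.comp hb
  have hdτ : Tendsto (fun n => deriv w (R.boundary (τ n))) atTop (𝓝 (deriv w (R.boundary τ₀))) :=
    hdc.tendsto.comp hb
  have hp0 := norm_pos_iff.2 (sub_ne_zero.2 h0)
  have hp1 := norm_pos_iff.2 (sub_ne_zero.2 h1)
  have hp3 := norm_pos_iff.2 (sub_ne_zero.2 h3)
  have hpos : 0 < ‖w (R.boundary τ₀) - w (R.pt 0)‖ ^ 2 * ‖w (R.boundary τ₀) - w (R.pt 1)‖ ^ 2 *
      ‖w (R.boundary τ₀) - w (R.pt 3)‖ ^ 2 := by positivity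
  exact hdτ.norm.mul (((((hwτ.sub_const _).norm.pow 2).mul ((hwτ.sub_const _).norm.pow 2)).mul
    ((hwτ.sub_const _).norm.pow 2)).rpow_const (Or.inl hpos.ne'))

/-! ### The uniform window statement for a given normaliser -/

/-- **Uniform point asymptotics on a flat window, for any normaliser extending `Π^{1/3}`.** In the
setting of the stub, fix `u₀ ∈ Ω` and let `N` agree with `Π(δ)^{1/3}` whenever the reference product
`Π(δ)` is positive. Then on every admissible window `∂Ω([σ, σ']) ⊆ U` separated by `w` from the poles
the renormalised weight `rowWeight R δ v/(δ N δ)` is within `ε` of `Φ_w(∂Ω(τ))` for all boundary-row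
`v` within `4δ` of `∂Ω(τ)`, `τ ∈ [σ, σ']`, eventually as `δ → 0⁺`. Proof by contradiction along
sequences (`Filter.frequently_iff_seq_forall`, `IsCompact.tendsto_subseq`, Part 2's `kpa_seq_limit`,
`kpa_tendsto_pointKernel`). [folklore] -/
theorem kpa_eventually_window_of_normaliser (R : ConformalRectangle) (hRect : IsRectilinear R)
    (hfl : ∀ i : Fin 4, ∃ r : ℝ, 0 < r ∧ FlatNear R (R.pt i) r)
    {U : Set ℂ} {w : ℂ → ℂ} (hU : IsOpen U) (hRU : R.carrier ⊆ U)
    (h0U : R.pt 0 ∈ U) (h1U : R.pt 1 ∈ U) (h3U : R.pt 3 ∈ U)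
    (hw : DifferentiableOn ℂ w U) (hbij : BijOn w R.carrier {z : ℂ | 0 < z.im})
    {u₀ : ℂ} (hu₀ : u₀ ∈ R.carrier) {N : ℝ → ℝ}
    (hN : ∀ δ : ℝ, 0 <
      dirichletGreen (closureFinset R δ) (nearestSite δ u₀) (markRow R δ 0) *
          (‖w u₀ - w (R.pt 0)‖ ^ 2 / (w u₀).im) *
        (dirichletGreen (closureFinset R δ) (nearestSite δ u₀) (markRow R δ 1) *
          (‖w u₀ - w (R.pt 1)‖ ^ 2 / (w u₀).im)) *
        (dirichletGreen (closureFinset R δ) (nearestSite δ u₀) (markRow R δ 3) *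
          (‖w u₀ - w (R.pt 3)‖ ^ 2 / (w u₀).im)) →
      N δ = (dirichletGreen (closureFinset R δ) (nearestSite δ u₀) (markRow R δ 0) *
          (‖w u₀ - w (R.pt 0)‖ ^ 2 / (w u₀).im) *
        (dirichletGreen (closureFinset R δ) (nearestSite δ u₀) (markRow R δ 1) *
          (‖w u₀ - w (R.pt 1)‖ ^ 2 / (w u₀).im)) *
        (dirichletGreen (closureFinset R δ) (nearestSite δ u₀) (markRow R δ 3) *
          (‖w u₀ - w (R.pt 3)‖ ^ 2 / (w u₀).im))) ^ (1 / 3 : ℝ))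
    {σ σ' : ℝ} (hadm : AdmissibleRange R σ σ') (hwinU : R.boundary '' Icc σ σ' ⊆ U)
    (hsep : ∀ τ ∈ Icc σ σ', w (R.boundary τ) ≠ w (R.pt 0) ∧ w (R.boundary τ) ≠ w (R.pt 1) ∧
      w (R.boundary τ) ≠ w (R.pt 3)) {ε : ℝ} (hε : 0 < ε) :
    ∀ᶠ δ in 𝓝[>] (0 : ℝ), ∀ v ∈ boundaryRow R δ, ∀ τ ∈ Icc σ σ',
      dist (meshPoint δ v) (R.boundary τ) ≤ 4 * δ →
        |rowWeight R δ v / (δ * N δ) -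
            ‖deriv w (R.boundary τ)‖ *
              (‖w (R.boundary τ) - w (R.pt 0)‖ ^ 2 * ‖w (R.boundary τ) - w (R.pt 1)‖ ^ 2 *
                  ‖w (R.boundary τ) - w (R.pt 3)‖ ^ 2) ^ (-(1 / 3 : ℝ))| ≤ ε := by
  -- the eventual good behaviour of the poles and of the reference site
  have hgood : ∀ᶠ δ in 𝓝[>] (0 : ℝ), 0 < δ ∧ (∀ i : Fin 4, markRow R δ i ∈ boundaryRow R δ ∧
      dist (meshPoint δ (markRow R δ i)) (R.pt i) < 2 * δ) ∧ nearestSite δ u₀ ∈ closureFinset R δ :=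
    (eventually_mem_nhdsWithin.mono fun δ hδ => hδ).and
      ((kpa_eventually_markRow R hfl).and (kpa_eventually_nearestSite_mem_closureFinset R hu₀))
  by_contra hcon
  push Not at hcon
  -- a sequence of meshes with violators
  obtain ⟨δs, hδs, hbad⟩ := Filter.frequently_iff_seq_forall.1 (hcon.and_eventually hgood)
  have hδpos : ∀ n, 0 < δs n := fun n => (hbad n).2.1
  have hδ0 : Tendsto δs atTop (𝓝 0) := hδs.mono_right nhdsWithin_le_nhds
  choose v hv τ hτ hdist hεlt using fun n => (hbad n).1
  -- compactness of the parameter window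
  obtain ⟨τ₀, hτ₀, φ, hφ, hτlim⟩ := isCompact_Icc.tendsto_subseq hτ
  have hx : R.boundary τ₀ ∈ frontier R.carrier := R.boundary_mem_frontier τ₀
  have hxU : R.boundary τ₀ ∈ U := hwinU ⟨τ₀, hτ₀, rfl⟩
  obtain ⟨-, -, -, r, hr, hflr⟩ := hadm
  obtain ⟨hx0, hx1, hx3⟩ := hsep τ₀ hτ₀
  -- the violators converge to `x = ∂Ω(τ₀)` along the subsequence
  have hbτ : Tendsto (fun n => R.boundary (τ (φ n))) atTop (𝓝 (R.boundary τ₀)) :=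
    (R.continuous_boundary.tendsto τ₀).comp hτlim
  have hax : Tendsto (fun n => meshPoint (δs (φ n)) (v (φ n))) atTop (𝓝 (R.boundary τ₀)) :=
    kpa_tendsto_of_dist_le_mul (hδ0.comp hφ.tendsto_atTop) 4 hbτ fun n => hdist (φ n)
  -- Part 2: the renormalised weight converges to the point kernel at `x`
  obtain ⟨hPpos, hlim⟩ := kpa_seq_limit R hRect hfl hU hRU h0U h1U h3U hw hbij hu₀ hx hxU
    ⟨r, hr, hflr τ₀ hτ₀⟩ hx0 hx1 hx3 (δ := fun n => δs (φ n)) (fun n => hδpos (φ n))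
    (hδ0.comp hφ.tendsto_atTop) (a := fun n => v (φ n)) (fun n => hv (φ n)) hax
    (fun n i => (hbad (φ n)).2.2.1 i) (fun n => (hbad (φ n)).2.2.2)
  -- hence so does `rowWeight/(δ N δ)` (the normaliser is `Π^{1/3}` eventually)
  have hlim' : Tendsto (fun n => rowWeight R (δs (φ n)) (v (φ n)) / (δs (φ n) * N (δs (φ n))))
      atTop (𝓝 (‖deriv w (R.boundary τ₀)‖ * (‖w (R.boundary τ₀) - w (R.pt 0)‖ ^ 2 *
        ‖w (R.boundary τ₀) - w (R.pt 1)‖ ^ 2 * ‖w (R.boundary τ₀) - w (R.pt 3)‖ ^ 2) ^ (-(1 / 3 : ℝ)))) := by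
    refine hlim.congr' ?_
    filter_upwards [hPpos] with n hn
    rw [hN _ hn]
  -- and the point kernel is continuous along the window: the violation is impossible
  have hΦ := kpa_tendsto_pointKernel R hU hw (τ := fun n => τ (φ n)) hτlim hxU hx0 hx1 hx3
  have hdiff := hlim'.sub hΦ
  rw [sub_self] at hdiff
  obtain ⟨n, hn⟩ := (Metric.tendsto_nhds.1 hdiff ε hε).exists
  rw [Real.dist_0_eq_abs] at hn
  exact lt_irrefl _ ((hεlt (φ n)).trans hn)

/-! ### The registered stub -/

/-- **Stub `stub_kernelPointAsymptotics` (registered statement, verbatim): uniform point asymptotics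
of the cube-root weight `rowWeight` on the closure discretisation near flat boundary windows.** With
the normaliser `N(δ) = Π(δ)^{1/3}` (`Π` the reference product at a fixed interior point, `N = 1` where
`Π ≤ 0`), this is `kpa_eventually_window_of_normaliser`; the random-walk input is the tree's PROVED
Chelkak–Smirnov Thm 3.13 fact `ChelkakSmirnov2011_boundaryNormalisedPoissonKernelLimit_holds`
(three poles, inverted, multiplied, cube-rooted — Part 2). [cite: ChelkakSmirnov2011, Thm. 3.13] -/
theorem stub_kernelPointAsymptotics :
    ∀ R : ConformalRectangle, IsRectilinear R → (∀ i : Fin 4, ∃ r : ℝ, 0 < r ∧ FlatNear R (R.pt i) r) →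
      ∀ (U : Set ℂ) (w : ℂ → ℂ), IsOpen U → R.carrier ⊆ U →
        R.pt 0 ∈ U → R.pt 1 ∈ U → R.pt 3 ∈ U →
        DifferentiableOn ℂ w U → BijOn w R.carrier {z : ℂ | 0 < z.im} →
        ∃ N : ℝ → ℝ, (∀ δ, 0 < N δ) ∧
          ∀ σ σ' : ℝ, AdmissibleRange R σ σ' → R.boundary '' Icc σ σ' ⊆ U →
            (∀ τ ∈ Icc σ σ', w (R.boundary τ) ≠ w (R.pt 0) ∧ w (R.boundary τ) ≠ w (R.pt 1) ∧
              w (R.boundary τ) ≠ w (R.pt 3)) →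
            ∀ ε : ℝ, 0 < ε → ∀ᶠ δ in 𝓝[>] (0 : ℝ), ∀ v ∈ boundaryRow R δ, ∀ τ ∈ Icc σ σ',
              dist (meshPoint δ v) (R.boundary τ) ≤ 4 * δ →
                |rowWeight R δ v / (δ * N δ) -
                    ‖deriv w (R.boundary τ)‖ *
                      (‖w (R.boundary τ) - w (R.pt 0)‖ ^ 2 * ‖w (R.boundary τ) - w (R.pt 1)‖ ^ 2 *
                          ‖w (R.boundary τ) - w (R.pt 3)‖ ^ 2) ^ (-(1 / 3 : ℝ))| ≤ ε := by
  intro R hRect hfl U w hU hRU h0U h1U h3U hw hbij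
  obtain ⟨u₀, hu₀⟩ := R.toJordanDomain.nonempty
  -- the reference product `Π(δ)` and the normaliser `N(δ) = Π(δ)^{1/3}` (`1` where `Π ≤ 0`)
  set P : ℝ → ℝ := fun δ =>
    dirichletGreen (closureFinset R δ) (nearestSite δ u₀) (markRow R δ 0) *
        (‖w u₀ - w (R.pt 0)‖ ^ 2 / (w u₀).im) *
      (dirichletGreen (closureFinset R δ) (nearestSite δ u₀) (markRow R δ 1) *
        (‖w u₀ - w (R.pt 1)‖ ^ 2 / (w u₀).im)) *
      (dirichletGreen (closureFinset R δ) (nearestSite δ u₀) (markRow R δ 3) *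
        (‖w u₀ - w (R.pt 3)‖ ^ 2 / (w u₀).im)) with hP
  refine ⟨fun δ => if 0 < P δ then P δ ^ (1 / 3 : ℝ) else 1, fun δ => ?_, fun σ σ' hadm hwinU hsep ε hε =>
    kpa_eventually_window_of_normaliser R hRect hfl hU hRU h0U h1U h3U hw hbij hu₀ (fun δ hδ => ?_) hadm
      hwinU hsep hε⟩
  · show 0 < (if 0 < P δ then P δ ^ (1 / 3 : ℝ) else 1)
    split_ifs with h
    · exact Real.rpow_pos_of_pos h _
    · exact one_pos
  · have hδ' : 0 < P δ := hδ
    show (if 0 < P δ then P δ ^ (1 / 3 : ℝ) else 1) = P δ ^ (1 / 3 : ℝ)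
    rw [if_pos hδ']

end Summit.CriticalPhenomena.CardyFormulaZ2.Cruxes.RectilinearCardy.ExcursionKernelCovariance

end
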